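import Literature.AnabelianGeometry.EtaleTheta.Discharge.Sec5ThetaSubquotientAutLaws
import Literature.AnabelianGeometry.EtaleTheta.Discharge.Sec5OfConnectedTemperoid

/-!
# [EtTh] §5 over `B^temp(Π^tp_X)⁰`: the laws hpre / hP / hgeom / hlift of `(P, ρ)` at `B_N^bs` for the GENUINE `ρ = rhoOfBiKummerData`

Mochizuki, *The étale theta function and its Frobenioid-theoretic manifestations*, Publ. RIMS **45** (2009), §5 p. 327 (PDF p. 101),
proof of Prop. 5.5 pp. 327–328 (PDF pp. 101–102), §5 p. 331 (PDF p. 105) ("the natural [surjective] outer homomorphism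
`Π^tp_X ↠ Aut_D(B_N^bs)`").  [cite: MochizukiEtTh2009, §5 p.327–331 (PDF pp.101–105)]

PROOF-ONLY (no definitions).  abc-iut cell, seat abc-iut-w4-d042 (gen 3), row «MERGE-PLAN row 2 (D) + G-w5d123-2 AT THE GENUINE (Q,P)»
(L2-lead R120).  The generic laws of `Discharge/Sec5ThetaSubquotientAutLaws.lean` (p429126; any `ρ : Γ →* Aut E` acting at a base
point by right translation) INSTANTIATED at abc-iut-L2-t4's genuine §5 data over the connected base (`Discharge/Sec5OfConnectedTemperoid.lean`):
the setting `S := BiKummerSetting.mkOfConnectedTemperoid X tf hZ hP NH A₀ hA₀ hA₀'` (Galois surjections := abc-iut-w5-d013's canonical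
`galoisSurjOf` read in `B^temp(Π^tp_X)⁰`), an `N`-th root `R` over it, the §2 data `T` with `ιX : T.PiX ≃ₜ* Π^tp_X`, and
`ρ := rhoOfBiKummerData R ιX : T.PiX →* Aut_D(B_N^bs)` (= `(ofConnectedTemperoidData …).ρ`, the `ρ` of the §5 data; `H_{B_N} = ρ(Π^tp_Ÿ)`).

* `rhoOfBiKummerData_obj_apply_base` — **`ρ` acts at the base point `x := (s^⊓_N)^bs(x_{A_N}) ∈ B_N^bs` by right translation**:
  `(ρ k)(x) = (ιX k)⁻¹ · x` (conjugation by `(s^⊓_N)^bs` of `galoisSurjOf_{A_N^bs}`, `galoisSurjOf_apply_base`), read on the underlying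
  `Π^tp_X`-set through `(connectedObjects _).ι.mapAut`;
* hence, for abc-iut-L2-t9's `(l·Δ_Θ)_(−)` with parameters `q : Π^tp_X →* Q`, `ι : Λ →* Q` and print's `Aut`-subquotient
  `P_{B_N^bs} := autPre q ι (B_N^bs) ↠ (l·Δ_Θ)_{B_N^bs}` via `autProj` (`ThetaSubquotientOfTemperedAut.lean`):
  **hpre** `rho_mem_autPre_of_mem_range` (`q (ιX k) ∈ L ⇒ ρ k ∈ P`), **hP at the base point** `evalAt_autProj_rhoOfBiKummerData`
  (`autProj (ρ k) ↦ [a]`, `ι a = q (ιX k)⁻¹`), **hgeom** `exists_eq_rho_of_mem_autPre_connected` / `autPre_le_map_rhoOfBiKummerData`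
  (EVERY element of `P_{B_N^bs}` is a `ρ k` with `q (ιX k) ∈ L`), **hlift** `exists_lift_rho_of_mem_autPre_connected` (inside any
  `H ≤ T.PiX` containing `Ker ρ = ιX⁻¹(N_{A_N})`), and `rhoOfBiKummerData_eq_one_iff_mem_stabilizer` (`ρ k = 1 ↔ ιX k ∈ Stab x`);
* `stabilizer_base_le_Hodot` — **`Stab(x) ≤ H_⊙`** (`A_N → A_⊙` along `α_N ≫ α_l`, and `H_⊙` is the stabiliser of every point of the
  Galois `A_⊙^bs`); hence for abc-iut-L2-t4's §5 choice `A_⊙^bs := Ÿ` (`mkOfConnectedTemperoidYdd`, `H_⊙ = ιX(Π^tp_Ÿ)`):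
  `stabilizer_base_comap_le_PiYdd` (**`ιX⁻¹(Stab x) ≤ Π^tp_Ÿ`** — print, §5 p.330: `B_N` is a covering of `Ÿ`) and the hlift law with
  `H := Π^tp_Ÿ` DISCHARGED of its subgroup hypothesis: `exists_lift_rho_PiYdd_of_mem_autPre` (an element `ρ k₀ ∈ H_{B_N} = ρ(Π^tp_Ÿ)`
  in `P_{B_N^bs}` lifts to `k ∈ Π^tp_Ÿ` with `q (ιX k) ∈ L`, `ρ k = ρ k₀` — abc-iut-w5-d123's binder `hlift` at these data, up to the
  `(Q, P)` packaging).

Credit (L2-lead R144): the conjugation-equivariance law hproj consumed here through p429126 (`map_autProj_eq_autProj_conj`,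
`thetaSubquotientStub_lDeltaMap_autProj_conj`) was obtained independently by abc-iut-w5-d249 (staged `Sec5SubquotientProjEquivarianceModel`,
`map_autProj_eq_autProj_conj` / `hproj_thetaSubquotientStub`, over their p428064 construction of the same `Aut`-projection, superseded in
the tree by abc-iut-L2-t9's text p427537 under the gate's unreferenced-removal rule).

What is NOT here (honest): the packaging of `⟨autPre, autProj⟩` as the `P : ThetaSubquotientProj 𝔉` argument of the consumers
(GAP-LEDGER G-w4d042g3-1: the frozen field `proj_surjective` asks onto at EVERY object; onto holds at Galois objects only), the choice
`Q := thetaSubquotientStub q ι` inside `ofConnectedTemperoidData` (a universe specialisation of the free `Q`), and the dictionary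
`T.lDeltaTheta = ιX⁻¹ q⁻¹ ι(Λ)` / `thetaMod` vs. `evalEquiv` between the §2 model and `(q, ι)` — the remaining binders of G-w5d123-2
for W3-L2-01 `ofSetting`.  Nothing here asserts anything about [EtTh]'s curves; no side taken on [IUTchIII] Cor. 3.12.
-/

noncomputable section

namespace Literature.AnabelianGeometry.EtaleTheta

open CategoryTheory Opposite Literature.AlgebraicGeometry.Frobenioids Literature.AnabelianGeometry.SemiGraphs
  Literature.AnabelianGeometry.SemiGraphs.GaloisObjects
open Literature.AlgebraicGeometry.Frobenioids.QuasiTemperoid (stabilizerSubgroup)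
open Literature.AlgebraicGeometry.Frobenioids.QuasiTemperoid.BTempConnected (hom_ρ ρ_mul_apply ρ_inv_apply ρ_apply_inv)

universe u₀ v₀ w v'

/-! ### Plumbing: `Aut`-conjugation by an isomorphism of `B^temp(Π)⁰`, read on points -/

namespace ThetaSubquotient

variable {G : Type u₀} [Group G] [TopologicalSpace G]

/-- For an isomorphism `β : A ≅ B` of `B^temp(Π)⁰` and `f ∈ Aut_D(A)`: the conjugate `β f β⁻¹ ∈ Aut_D(B)`, read on the underlying
`Π`-set of `B` through the inclusion `B^temp(Π)⁰ ⥤ B^temp(Π)`, maps `β(y)` to `β(f(y))`.  [cite: MochizukiEtTh2009, §5 p.331 (PDF p.105)] -/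
theorem mapAut_conjAut_apply {A B : ConnectedPart (BTemp G)} (β : A ≅ B) (f : Aut A) (y : A.obj.obj.V) :
    ((Functor.mapAut B (connectedObjects (BTemp G)).ι (β.conjAut f)).hom.hom.hom (β.hom.hom.hom.hom y) : B.obj.obj.V) =
      β.hom.hom.hom.hom (f.hom.hom.hom.hom y) := by
  change ((β.conjAut f).hom.hom.hom.hom (β.hom.hom.hom.hom y) : B.obj.obj.V) = _
  rw [Iso.conjAut_hom, Iso.conj_apply]
  change ((β.inv.hom ≫ f.hom.hom ≫ β.hom.hom).hom.hom (β.hom.hom.hom.hom y) : B.obj.obj.V) = _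
  rw [GaloisObjects.comp_apply, GaloisObjects.comp_apply, ← GaloisObjects.comp_apply β.hom.hom β.inv.hom,
    ObjectProperty.isoHom_inv_id_hom, GaloisObjects.id_apply]

end ThetaSubquotient

namespace ThetaFrobenioid

section Connected

variable {K : Type u₀} [Field K] {X : SemiGraphs.TemperedArithmeticGroup.{u₀} K} {D₀ : Type u₀} [Category.{v₀} D₀]
  {V : FrdIMonoidStub.{w}} {T₀ : RealifiedDivisorMonoids (D₀ := D₀) V}
  {VD : FrdICatStub.{u₀ + 1, u₀, w} (ConnectedPart (BTemp X.Pi))}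
  {tf : TemperedFrobenioid T₀ (ConnectedPart (BTemp X.Pi)) VD} {hZ : tf.monoidType = MonoidType.Z}
  {hP : ∀ A : (ConnectedPart (BTemp X.Pi))ᵒᵖ, IsPerfect (tf.Φ.carrier A)}
  {NH : Subgroup (Field.absoluteGaloisGroup K) → tf.category → ℕ+ → Prop} {A₀ : tf.category}
  {hA₀ : PreFrobenioid.IsFrobeniusTrivial tf.toElem A₀} {hA₀' : SemiGraphs.IsGaloisObj A₀.base.obj}
  {pullFrac : ∀ {A A' : (BiKummerSetting.mkOfConnectedTemperoid X tf hZ hP NH A₀ hA₀ hA₀').C} (_ : A' ⟶ A),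
    (BiKummerSetting.mkOfConnectedTemperoid X tf hZ hP NH A₀ hA₀ hA₀').biratUnits A →
      (BiKummerSetting.mkOfConnectedTemperoid X tf hZ hP NH A₀ hA₀ hA₀').biratUnits A'}
  {lv : ℕ+}
  {θ : (BiKummerSetting.mkOfConnectedTemperoid X tf hZ hP NH A₀ hA₀ hA₀').biratUnits
    (BiKummerSetting.mkOfConnectedTemperoid X tf hZ hP NH A₀ hA₀ hA₀').Aodot}
  {Bl : (BiKummerSetting.mkOfConnectedTemperoid X tf hZ hP NH A₀ hA₀ hA₀').C}
  {Pl : (BiKummerSetting.mkOfConnectedTemperoid X tf hZ hP NH A₀ hA₀ hA₀').FractionPair θ Bl}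
  {Rl : (BiKummerSetting.mkOfConnectedTemperoid X tf hZ hP NH A₀ hA₀ hA₀').NthRoot θ Pl lv pullFrac}
  {N : ℕ+} {T : ThetaEnvData.{max u₀ w} N}
  (R : (BiKummerSetting.mkOfConnectedTemperoid X tf hZ hP NH A₀ hA₀ hA₀').NthRoot Rl.root Rl.pair N pullFrac)
  (ιX : T.PiX ≃ₜ* X.Pi)

/-- **`ρ = rhoOfBiKummerData` acts at the base point `x := (s^⊓_N)^bs(x_{A_N})` of `B_N^bs` by right translation**: on the underlying
`Π^tp_X`-set, `(ρ k)(x) = (ιX k)⁻¹ · x` — `ρ` is `galoisSurjOf_{A_N^bs}` ([SemiAnbd] Rmk. 3.1.3, `galoisSurjOf_apply_base`) conjugated by the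
base isomorphism `(s^⊓_N)^bs : A_N^bs ⥲ B_N^bs` of the root (§5 p.331).  [cite: MochizukiEtTh2009, §5 p.331 (PDF p.105)] -/
theorem rhoOfBiKummerData_obj_apply_base (k : T.PiX) :
    (((Functor.mapAut R.BN.base (connectedObjects (BTemp X.Pi)).ι).comp (rhoOfBiKummerData R ιX) k).hom.hom.hom
        ((BiKummerSetting.NthRoot.baseIso _ R).hom.hom.hom.hom
          (galoisBase X.isTempered R.AN.base.obj R.αData.isGalois)) : R.BN.base.obj.obj.V) =
      R.BN.base.obj.obj.ρ (ιX.toMonoidHom k)⁻¹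
        ((BiKummerSetting.NthRoot.baseIso _ R).hom.hom.hom.hom (galoisBase X.isTempered R.AN.base.obj R.αData.isGalois)) := by
  rw [MonoidHom.comp_apply, rhoOfBiKummerData_apply, ThetaSubquotient.mapAut_conjAut_apply]
  change ((BiKummerSetting.NthRoot.baseIso _ R).hom.hom.hom.hom
      ((galoisSurjOf X.isTempered R.AN.base.obj R.αData.isGalois (ιX k)).hom.hom.hom
        (galoisBase X.isTempered R.AN.base.obj R.αData.isGalois)) : R.BN.base.obj.obj.V) = _
  rw [galoisSurjOf_apply_base, hom_ρ]
  rfl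

/-- `ρ k`, read on the underlying `Π^tp_X`-set, is trivial iff `ιX k` stabilises the base point of `B_N^bs`.
[cite: MochizukiEtTh2009, §5 p.331 (PDF p.105)] -/
theorem mapAut_rhoOfBiKummerData_eq_one_iff (k : T.PiX) :
    ((Functor.mapAut R.BN.base (connectedObjects (BTemp X.Pi)).ι).comp (rhoOfBiKummerData R ιX)) k = 1 ↔ ιX.toMonoidHom k ∈ stabilizerSubgroup R.BN.base.obj ((BiKummerSetting.NthRoot.baseIso _ R).hom.hom.hom.hom (galoisBase X.isTempered R.AN.base.obj R.αData.isGalois)) :=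
  ThetaSubquotient.rho_eq_one_iff_mem_stabilizer ((BiKummerSetting.NthRoot.baseIso _ R).hom.hom.hom.hom (galoisBase X.isTempered R.AN.base.obj R.αData.isGalois)) ιX.toMonoidHom ((Functor.mapAut R.BN.base (connectedObjects (BTemp X.Pi)).ι).comp (rhoOfBiKummerData R ιX)) (rhoOfBiKummerData_obj_apply_base R ιX) R.BN.base.property k

/-- **`Ker ρ = ιX⁻¹(Stab x)`**: `ρ k = 1 ↔ ιX k` stabilises the base point `x` of `B_N^bs` (equivalently any point of `A_N^bs`,
`rho_ofConnectedTemperoidData_eq_one_iff`).  [cite: MochizukiEtTh2009, §5 p.331 (PDF p.105)] -/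
theorem rhoOfBiKummerData_eq_one_iff_mem_stabilizer (k : T.PiX) :
    rhoOfBiKummerData R ιX k = 1 ↔ ιX.toMonoidHom k ∈ stabilizerSubgroup R.BN.base.obj ((BiKummerSetting.NthRoot.baseIso _ R).hom.hom.hom.hom (galoisBase X.isTempered R.AN.base.obj R.αData.isGalois)) := by
  rw [← mapAut_rhoOfBiKummerData_eq_one_iff R ιX k, MonoidHom.comp_apply]
  constructor
  · intro h
    rw [h, map_one]
  · intro h
    apply Iso.ext
    apply ObjectProperty.hom_ext
    exact congrArg Iso.hom h

/-- **`Stab(x) ≤ H_⊙`**: the stabiliser of the base point `x` of `B_N^bs` (= that of `x_{A_N}`, `(s^⊓_N)^bs` being an isomorphism) is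
contained in `H_⊙` — `A_N` maps to `A_⊙` (`α_N ≫ α_l`, the `N`-th root of the `l`-th root of `Θ̈` on `A_⊙`, Prop. 4.2 (iii)), and `H_⊙`
is the stabiliser of every point of the Galois object `A_⊙^bs` (`mem_Hodot_mkOfConnectedTemperoid_iff`).
[cite: MochizukiEtTh2009, §5 p.330 (PDF p.104); Prop 4.2 (iii) p.314 (PDF p.88)] -/
theorem stabilizer_base_le_Hodot :
    stabilizerSubgroup R.BN.base.obj ((BiKummerSetting.NthRoot.baseIso _ R).hom.hom.hom.hom (galoisBase X.isTempered R.AN.base.obj R.αData.isGalois)) ≤ (BiKummerSetting.mkOfConnectedTemperoid X tf hZ hP NH A₀ hA₀ hA₀').Hodot := by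
  intro g hg
  -- `g` stabilises `x_{A_N}`
  have h1 : g ∈ stabilizerSubgroup R.AN.base.obj (galoisBase X.isTempered R.AN.base.obj R.αData.isGalois) := by
    have h := ThetaSubquotient.stabilizerSubgroup_le_of_hom (BiKummerSetting.NthRoot.baseIso _ R).inv.hom _ hg
    rwa [← GaloisObjects.comp_apply, ObjectProperty.isoHom_inv_id_hom, GaloisObjects.id_apply] at h
  -- hence the image of `x_{A_N}` in `A_⊙^bs` under `Base(α_N ≫ α_l)`
  have h2 := ThetaSubquotient.stabilizerSubgroup_le_of_hom (ModelFrobenioid.baseMap (R.α ≫ Rl.α)).hom _ h1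
  exact (BiKummerSetting.mem_Hodot_mkOfConnectedTemperoid_iff X tf hZ hP NH A₀ hA₀ hA₀' _ g).2 h2

/-- Hence `ιX⁻¹(Stab x) ≤ ιX⁻¹(H_⊙)`: the subgroup `H` of the hlift law may be taken to be any `H ⊇ ιX⁻¹(H_⊙)` — for the §5 choice
`A_⊙^bs := Ÿ`, `H := Π^tp_Ÿ` (`stabilizer_base_comap_le_PiYdd`).  [cite: MochizukiEtTh2009, §5 p.330 (PDF p.104)] -/
theorem stabilizer_base_comap_le_Hodot_comap :
    (stabilizerSubgroup R.BN.base.obj ((BiKummerSetting.NthRoot.baseIso _ R).hom.hom.hom.hom (galoisBase X.isTempered R.AN.base.obj R.αData.isGalois))).comap ιX.toMonoidHom ≤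
      (BiKummerSetting.mkOfConnectedTemperoid X tf hZ hP NH A₀ hA₀ hA₀').Hodot.comap ιX.toMonoidHom :=
  Subgroup.comap_mono (stabilizer_base_le_Hodot R)

variable {Q' : Type v'} [Group Q'] {Λ : Type u₀} [CommGroup Λ] (q : X.Pi →* Q') (ι : Λ →* Q')

/-- **hgeom at the genuine data, pointwise**: EVERY element of `P_{B_N^bs}` is `ρ k` for some `k` with `q (ιX k) ∈ L`.
[cite: MochizukiEtTh2009, §5 p.327 (PDF p.101)] -/
theorem exists_eq_mapAut_rho_of_mem_autPre {σ : Aut R.BN.base.obj} (hσ : σ ∈ ThetaSubquotient.autPre q ι R.BN.base.obj) :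
    ∃ k : T.PiX, q (ιX.toMonoidHom k) ∈ ι.range ∧ ((Functor.mapAut R.BN.base (connectedObjects (BTemp X.Pi)).ι).comp (rhoOfBiKummerData R ιX)) k = σ :=
  ThetaSubquotient.exists_eq_rho_of_mem_autPre q ι ((BiKummerSetting.NthRoot.baseIso _ R).hom.hom.hom.hom (galoisBase X.isTempered R.AN.base.obj R.αData.isGalois)) ιX.toMonoidHom ((Functor.mapAut R.BN.base (connectedObjects (BTemp X.Pi)).ι).comp (rhoOfBiKummerData R ιX)) (rhoOfBiKummerData_obj_apply_base R ιX) R.BN.base.property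
    ιX.surjective hσ

/-- **hgeom at the genuine data**: `P_{B_N^bs} ≤ ρ(ιX⁻¹ q⁻¹ L)`.  [cite: MochizukiEtTh2009, §5 p.327 (PDF p.101)] -/
theorem autPre_le_map_mapAut_rhoOfBiKummerData :
    ThetaSubquotient.autPre q ι R.BN.base.obj ≤ ((ι.range.comap q).comap ιX.toMonoidHom).map ((Functor.mapAut R.BN.base (connectedObjects (BTemp X.Pi)).ι).comp (rhoOfBiKummerData R ιX)) :=
  ThetaSubquotient.autPre_le_map_rho q ι ((BiKummerSetting.NthRoot.baseIso _ R).hom.hom.hom.hom (galoisBase X.isTempered R.AN.base.obj R.αData.isGalois)) ιX.toMonoidHom ((Functor.mapAut R.BN.base (connectedObjects (BTemp X.Pi)).ι).comp (rhoOfBiKummerData R ιX)) (rhoOfBiKummerData_obj_apply_base R ιX) R.BN.base.property ιX.surjective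

/-- **hlift at the genuine data**: an element `ρ k₀` of `P_{B_N^bs}` with `k₀ ∈ H`, `H ≤ T.PiX` any subgroup containing
`ιX⁻¹(Stab x) = Ker ρ` (e.g. `H = Π^tp_Ÿ`, since `B_N` is a covering of `Ÿ` — §5 p.330), lifts to `k ∈ H` with `q (ιX k) ∈ L` and
`ρ k = ρ k₀`.  [cite: MochizukiEtTh2009, Prop 5.5 proof p.327–328 (PDF pp.101–102)] -/
theorem exists_lift_mapAut_rho_of_mem_autPre (H : Subgroup T.PiX)
    (hH : (stabilizerSubgroup R.BN.base.obj ((BiKummerSetting.NthRoot.baseIso _ R).hom.hom.hom.hom (galoisBase X.isTempered R.AN.base.obj R.αData.isGalois))).comap ιX.toMonoidHom ≤ H)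
    {k₀ : T.PiX} (hk₀ : k₀ ∈ H) (hm : ((Functor.mapAut R.BN.base (connectedObjects (BTemp X.Pi)).ι).comp (rhoOfBiKummerData R ιX)) k₀ ∈ ThetaSubquotient.autPre q ι R.BN.base.obj) :
    ∃ k ∈ H, q (ιX.toMonoidHom k) ∈ ι.range ∧ ((Functor.mapAut R.BN.base (connectedObjects (BTemp X.Pi)).ι).comp (rhoOfBiKummerData R ιX)) k = ((Functor.mapAut R.BN.base (connectedObjects (BTemp X.Pi)).ι).comp (rhoOfBiKummerData R ιX)) k₀ :=
  ThetaSubquotient.exists_lift_of_rho_mem_autPre q ι ((BiKummerSetting.NthRoot.baseIso _ R).hom.hom.hom.hom (galoisBase X.isTempered R.AN.base.obj R.αData.isGalois)) ιX.toMonoidHom ((Functor.mapAut R.BN.base (connectedObjects (BTemp X.Pi)).ι).comp (rhoOfBiKummerData R ιX)) (rhoOfBiKummerData_obj_apply_base R ιX) R.BN.base.property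
    ιX.surjective H hH hk₀ hm

/-- The same lift with the conclusion on `ρ` itself (`ρ k = ρ k₀` in `Aut_D(B_N^bs)`).
[cite: MochizukiEtTh2009, Prop 5.5 proof p.327–328 (PDF pp.101–102)] -/
theorem exists_lift_rho_of_mem_autPre (H : Subgroup T.PiX)
    (hH : (stabilizerSubgroup R.BN.base.obj ((BiKummerSetting.NthRoot.baseIso _ R).hom.hom.hom.hom (galoisBase X.isTempered R.AN.base.obj R.αData.isGalois))).comap ιX.toMonoidHom ≤ H)
    {k₀ : T.PiX} (hk₀ : k₀ ∈ H) (hm : ((Functor.mapAut R.BN.base (connectedObjects (BTemp X.Pi)).ι).comp (rhoOfBiKummerData R ιX)) k₀ ∈ ThetaSubquotient.autPre q ι R.BN.base.obj) :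
    ∃ k ∈ H, q (ιX.toMonoidHom k) ∈ ι.range ∧ rhoOfBiKummerData R ιX k = rhoOfBiKummerData R ιX k₀ := by
  obtain ⟨k, hk, hq, he⟩ := exists_lift_mapAut_rho_of_mem_autPre R ιX q ι H hH hk₀ hm
  refine ⟨k, hk, hq, ?_⟩
  have h1 : ((Functor.mapAut R.BN.base (connectedObjects (BTemp X.Pi)).ι).comp (rhoOfBiKummerData R ιX)) (k * k₀⁻¹) = 1 := by rw [map_mul, map_inv, he, mul_inv_cancel]
  have h2 : rhoOfBiKummerData R ιX (k * k₀⁻¹) = 1 := by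
    rw [MonoidHom.comp_apply] at h1
    apply Iso.ext
    apply ObjectProperty.hom_ext
    exact congrArg Iso.hom h1
  rw [map_mul, map_inv, mul_inv_eq_one] at h2
  exact h2

variable [ι.range.Normal]

/-- **hpre at the genuine data**: if `q (ιX k) ∈ L` then `ρ k`, read on the underlying `Π^tp_X`-set of `B_N^bs`, lies in print's
`Aut`-subquotient domain `P_{B_N^bs} = autPre q ι`.  [cite: MochizukiEtTh2009, §5 p.327 (PDF p.101)] -/
theorem mapAut_rho_mem_autPre_of_mem_range (k : T.PiX) (hk : q (ιX.toMonoidHom k) ∈ ι.range) :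
    ((Functor.mapAut R.BN.base (connectedObjects (BTemp X.Pi)).ι).comp (rhoOfBiKummerData R ιX)) k ∈ ThetaSubquotient.autPre q ι R.BN.base.obj :=
  ThetaSubquotient.mem_autPre_of_rho_apply_base q ι ((BiKummerSetting.NthRoot.baseIso _ R).hom.hom.hom.hom (galoisBase X.isTempered R.AN.base.obj R.αData.isGalois)) ιX.toMonoidHom ((Functor.mapAut R.BN.base (connectedObjects (BTemp X.Pi)).ι).comp (rhoOfBiKummerData R ιX)) (rhoOfBiKummerData_obj_apply_base R ιX) R.BN.base.property k hk

/-- **hP at the genuine data (base point)**: `autProj (ρ k)` evaluates at `x` to the class of `a` whenever `ι a = q (ιX k)⁻¹`; with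
abc-iut-L2-t9's `evalEquiv` this is `P.proj ∘ ρ = e ∘ (k ↦ [q (ιX k)⁻¹])` on `ιX⁻¹q⁻¹L` for a bijective `e`.
[cite: MochizukiEtTh2009, §5 p.327 (PDF p.101)] -/
theorem evalAt_autProj_rhoOfBiKummerData (k : T.PiX) (a : Λ) (ha : ι a = q (ιX.toMonoidHom k)⁻¹)
    (hm : ((Functor.mapAut R.BN.base (connectedObjects (BTemp X.Pi)).ι).comp (rhoOfBiKummerData R ιX)) k ∈ ThetaSubquotient.autPre q ι R.BN.base.obj) :
    ThetaSubquotient.evalAt q ι R.BN.base.obj ((BiKummerSetting.NthRoot.baseIso _ R).hom.hom.hom.hom (galoisBase X.isTempered R.AN.base.obj R.αData.isGalois)) (ThetaSubquotient.autProj q ι R.BN.base.obj ⟨_, hm⟩) = QuotientGroup.mk a :=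
  ThetaSubquotient.evalAt_autProj_rho q ι ((BiKummerSetting.NthRoot.baseIso _ R).hom.hom.hom.hom (galoisBase X.isTempered R.AN.base.obj R.αData.isGalois)) ιX.toMonoidHom ((Functor.mapAut R.BN.base (connectedObjects (BTemp X.Pi)).ι).comp (rhoOfBiKummerData R ιX)) (rhoOfBiKummerData_obj_apply_base R ιX) k a ha hm

end Connected

section Ydd

variable {K : Type u₀} [Field K] {X : SemiGraphs.TemperedArithmeticGroup.{u₀} K} {D₀ : Type u₀} [Category.{v₀} D₀]
  {V : FrdIMonoidStub.{w}} {T₀ : RealifiedDivisorMonoids (D₀ := D₀) V}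
  {VD : FrdICatStub.{u₀ + 1, u₀, w} (ConnectedPart (BTemp X.Pi))}
  {tf : TemperedFrobenioid T₀ (ConnectedPart (BTemp X.Pi)) VD} {hZ : tf.monoidType = MonoidType.Z}
  {hP : ∀ A : (ConnectedPart (BTemp X.Pi))ᵒᵖ, IsPerfect (tf.Φ.carrier A)}
  {NH : Subgroup (Field.absoluteGaloisGroup K) → tf.category → ℕ+ → Prop}
  {lv N : ℕ+} {T : ThetaEnvData.{max u₀ w} N} {ιX : T.PiX ≃ₜ* X.Pi}
  {pullFrac : ∀ {A A' : (BiKummerSetting.mkOfConnectedTemperoidYdd X tf hZ hP NH T ιX).C} (_ : A' ⟶ A),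
    (BiKummerSetting.mkOfConnectedTemperoidYdd X tf hZ hP NH T ιX).biratUnits A →
      (BiKummerSetting.mkOfConnectedTemperoidYdd X tf hZ hP NH T ιX).biratUnits A'}
  {θ : (BiKummerSetting.mkOfConnectedTemperoidYdd X tf hZ hP NH T ιX).biratUnits
    (BiKummerSetting.mkOfConnectedTemperoidYdd X tf hZ hP NH T ιX).Aodot}
  {Bl : (BiKummerSetting.mkOfConnectedTemperoidYdd X tf hZ hP NH T ιX).C}
  {Pl : (BiKummerSetting.mkOfConnectedTemperoidYdd X tf hZ hP NH T ιX).FractionPair θ Bl}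
  {Rl : (BiKummerSetting.mkOfConnectedTemperoidYdd X tf hZ hP NH T ιX).NthRoot θ Pl lv pullFrac}
  (R : (BiKummerSetting.mkOfConnectedTemperoidYdd X tf hZ hP NH T ιX).NthRoot Rl.root Rl.pair N pullFrac)

/-- **For `A_⊙^bs := Ÿ`: `ιX⁻¹(Stab x) ≤ Π^tp_Ÿ`** (print, §5 p.330: `B_N` is a [tempered] covering of `Ÿ`) — `H_⊙ = ιX(Π^tp_Ÿ)`
(`mem_Hodot_mkOfConnectedTemperoidYdd_iff`).  [cite: MochizukiEtTh2009, §5 p.330 (PDF p.104)] -/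
theorem stabilizer_base_comap_le_PiYdd :
    (stabilizerSubgroup R.BN.base.obj
        ((BiKummerSetting.NthRoot.baseIso _ R).hom.hom.hom.hom (galoisBase X.isTempered R.AN.base.obj R.αData.isGalois))).comap
      ιX.toMonoidHom ≤ T.PiYdd := by
  intro k hk
  have h := (BiKummerSetting.mem_Hodot_mkOfConnectedTemperoidYdd_iff X tf hZ hP NH T ιX (ιX.toMonoidHom k)).1
    (stabilizer_base_le_Hodot R hk)
  change ιX.symm (ιX k) ∈ T.PiYdd at h
  rwa [ιX.symm_apply_apply] at h

variable {Q' : Type v'} [Group Q'] {Λ : Type u₀} [CommGroup Λ] (q : X.Pi →* Q') (ι : Λ →* Q')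

/-- **hlift at the genuine data with `A_⊙^bs := Ÿ`, VERBATIM up to the `(Q, P)` packaging**: an element `ρ k₀ ∈ H_{B_N} = ρ(Π^tp_Ÿ)`
(`k₀ ∈ Π^tp_Ÿ`) lying in `P_{B_N^bs}` lifts to `k ∈ Π^tp_Ÿ` with `q (ιX k) ∈ L` (print: `∈ l·Δ_Θ`) and `ρ k = ρ k₀` — the binder `hlift`
of abc-iut-w5-d123's `exists_eta_etaTautological_ofBiKummerData` (p418694) / abc-iut-w5-d020's p420788 at these data.
[cite: MochizukiEtTh2009, Prop 5.5 proof p.327–328 (PDF pp.101–102)] -/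
theorem exists_lift_rho_PiYdd_of_mem_autPre {k₀ : T.PiX} (hk₀ : k₀ ∈ T.PiYdd)
    (hm : ((Functor.mapAut R.BN.base (connectedObjects (BTemp X.Pi)).ι).comp (rhoOfBiKummerData R ιX)) k₀ ∈
      ThetaSubquotient.autPre q ι R.BN.base.obj) :
    ∃ k ∈ T.PiYdd, q (ιX.toMonoidHom k) ∈ ι.range ∧ rhoOfBiKummerData R ιX k = rhoOfBiKummerData R ιX k₀ :=
  exists_lift_rho_of_mem_autPre R ιX q ι T.PiYdd (stabilizer_base_comap_le_PiYdd R) hk₀ hm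

end Ydd

end ThetaFrobenioid

end Literature.AnabelianGeometry.EtaleTheta
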